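import Mathlib
import HarnessLib
import Summits.Ventures.LatticeQCDFlow.Exactness.IMHMultipleTryExact

/-!
# Off-diagonal domination orders the one-step Dirichlet form and the lag-one autocorrelation of EVERY observable (general state space) —
# and the multiple-try flow sampler therefore decorrelates every observable at lag one at least as much as pool selection

HONEST FRAMING: exact (Metropolis-corrected) sampling algorithms for lattice gauge theory;
figures of merit are autocorrelation/cost numbers at stated couplings and volumes; no
continuum-physics claim.

Venture `LatticeQCDFlow` (cell pub-lqcd), topic `Exactness`; FANOUT row 30 (lean-1, GEN-42).  NEW WORK of the cell over Mathlib and this generation's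
`IMHMultipleTryExact` (§5: the multiple-try kernel dominates GEN-41's pool-selection kernel on every set not containing the current state).  The
ONE-STEP half of the Peskun–Tierney ordering on a general state space: if `P₂(x, B) ≤ P₁(x, B)` for every `B ∌ x`, then for every measurable `f`
the Dirichlet form `½∫∫ (f(x) − f(y))² P(x, dy)π(dx)` is larger for `P₁`, and — both kernels leaving `π` invariant — the stationary lag-one product
moment `∫∫ f(x)f(y) P(x, dy)π(dx)` is SMALLER for `P₁` (nonnegative bounded `f`).  The full asymptotic-variance ordering (all lags) is Tierney's
1998 theorem and is NOT formalised here; the tree's `Literature/…/PeskunOrdering.lean` has the finite-state version.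

## Results (no `sorry`, no new definitions)
* §1 `lintegral_le_of_offDiag_le` — off-diagonal domination at `x` transfers to every `g ≥ 0` vanishing at `x`:
  `∫ g dP₂(x, ·) ≤ ∫ g dP₁(x, ·)` (`MeasurableSingletonClass`); **`sqDiff_lintegral_mono`** — `∫∫ (f x − f y)² P₂ dπ ≤ ∫∫ (f x − f y)² P₁ dπ`.
* §2 `sqDiff_add_two_cross_eq` — for a `π`-invariant Markov `P` and measurable `f ≥ 0`: `∫∫ (f x − f y)² P dπ + 2∫∫ f(x)f(y) P dπ = 2∫ f² dπ`;
  **`lagOne_cross_antitone`** — hence for `0 ≤ f ≤ c` (`π` finite): `∫∫ f(x)f(y) P₁(x, dy)π(dx) ≤ ∫∫ f(x)f(y) P₂(x, dy)π(dx)`: THE DOMINATING KERNEL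
  HAS THE SMALLER STATIONARY LAG-ONE AUTOCORRELATION FOR EVERY SUCH OBSERVABLE.
* §3 **`multiProposal_lagOne_ge_mtm`** — the instance: for the same flow `q`, normalised weight `w > 0` and batch size `n`, the multiple-try
  sampler's stationary lag-one product moment of every `0 ≤ f ≤ c` is at most the pool-selection sampler's (both def-free, both exact for
  `π = w·q` by GEN-41 and `IMHMultipleTryExact`).
Reading (gauge files): between the two exact ways of spending a batch of flow proposals, the multiple-try rule never has the larger lag-one
autocorrelation of any bounded observable of the gauge field, at equilibrium.  NOT CLAIMED: the ordering of INTEGRATED autocorrelation times ∕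
asymptotic variances (needs all lags: Peskun–Tierney), anything away from equilibrium.
-/

noncomputable section

namespace Summit.Ventures.LatticeQCDFlow.Exactness

open MeasureTheory ProbabilityTheory Function Finset
open scoped ENNReal

variable {Ω : Type*} [MeasurableSpace Ω]

/-! ## §1 Off-diagonal domination and the one-step Dirichlet form -/

/-- **Off-diagonal domination transfers to vanishing integrands**: if `P₂(x, B) ≤ P₁(x, B)` for every measurable `B ∌ x`, then
`∫ g dP₂(x, ·) ≤ ∫ g dP₁(x, ·)` for every measurable `g ≥ 0` with `g(x) = 0`. [ours] -/
theorem lintegral_le_of_offDiag_le [MeasurableSingletonClass Ω] (P₁ P₂ : Kernel Ω Ω) (x : Ω)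
    (hdom : ∀ ⦃B : Set Ω⦄, MeasurableSet B → x ∉ B → P₂ x B ≤ P₁ x B) {g : Ω → ℝ≥0∞} (hgx : g x = 0) :
    ∫⁻ y, g y ∂(P₂ x) ≤ ∫⁻ y, g y ∂(P₁ x) := by
  -- `g` vanishes at `x`, so both integrals live on `{x}ᶜ`
  have hsplit : ∀ (ν : Measure Ω), ∫⁻ y, g y ∂ν = ∫⁻ y in {x}ᶜ, g y ∂ν := fun ν => by
    rw [← lintegral_add_compl _ (measurableSet_singleton x), lintegral_singleton, hgx, zero_mul, zero_add]
  rw [hsplit (P₂ x), hsplit (P₁ x)]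
  refine lintegral_mono' (Measure.le_iff.2 fun B hB => ?_) le_rfl
  rw [Measure.restrict_apply hB, Measure.restrict_apply hB]
  exact hdom (hB.inter (measurableSet_singleton x).compl) fun h => h.2 rfl

/-- **THE ONE-STEP DIRICHLET FORM IS MONOTONE UNDER OFF-DIAGONAL DOMINATION**: `∫∫ (f x − f y)² P₂(x, dy)π(dx) ≤ ∫∫ (f x − f y)² P₁(x, dy)π(dx)` for
every measurable real `f` and every measure `π`. [ours] -/
theorem sqDiff_lintegral_mono [MeasurableSingletonClass Ω] (P₁ P₂ : Kernel Ω Ω)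
    (hdom : ∀ x ⦃B : Set Ω⦄, MeasurableSet B → x ∉ B → P₂ x B ≤ P₁ x B) (π : Measure Ω) (f : Ω → ℝ) :
    ∫⁻ x, ∫⁻ y, ENNReal.ofReal ((f x - f y) ^ 2) ∂(P₂ x) ∂π ≤ ∫⁻ x, ∫⁻ y, ENNReal.ofReal ((f x - f y) ^ 2) ∂(P₁ x) ∂π :=
  lintegral_mono fun x => lintegral_le_of_offDiag_le P₁ P₂ x (hdom x) (by simp)

/-! ## §2 Invariance turns the Dirichlet form into a lag-one product moment -/

/-- **`∫∫ (f x − f y)² P dπ + 2∫∫ f(x)f(y) P dπ = 2∫ f² dπ`** for a `π`-invariant Markov kernel `P` and measurable `f ≥ 0`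
(pointwise `(a − b)² + 2ab = a² + b²`, then `∫ (P f²) dπ = ∫ f² dπ`). [ours] -/
theorem sqDiff_add_two_cross_eq (P : Kernel Ω Ω) [IsMarkovKernel P] (π : Measure Ω) (hinv : Kernel.Invariant P π) {f : Ω → ℝ}
    (hf : Measurable f) (hf0 : ∀ x, 0 ≤ f x) :
    ∫⁻ x, ∫⁻ y, ENNReal.ofReal ((f x - f y) ^ 2) ∂(P x) ∂π + 2 * ∫⁻ x, ∫⁻ y, ENNReal.ofReal (f x * f y) ∂(P x) ∂π =
      2 * ∫⁻ x, ENNReal.ofReal (f x ^ 2) ∂π := by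
  have hF : Measurable fun z : Ω × Ω => ENNReal.ofReal ((f z.1 - f z.2) ^ 2) :=
    (((hf.comp measurable_fst).sub (hf.comp measurable_snd)).pow_const 2).ennreal_ofReal
  have hG : Measurable fun z : Ω × Ω => ENNReal.ofReal (f z.1 * f z.2) := ((hf.comp measurable_fst).mul (hf.comp measurable_snd)).ennreal_ofReal
  have hsq : Measurable fun x => ENNReal.ofReal (f x ^ 2) := (hf.pow_const 2).ennreal_ofReal
  -- pointwise identity inside the inner integral
  have hin : ∀ x, ∫⁻ y, ENNReal.ofReal ((f x - f y) ^ 2) ∂(P x) + 2 * ∫⁻ y, ENNReal.ofReal (f x * f y) ∂(P x) =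
      ENNReal.ofReal (f x ^ 2) + ∫⁻ y, ENNReal.ofReal (f y ^ 2) ∂(P x) := by
    intro x
    have hGx : Measurable fun y => ENNReal.ofReal (f x * f y) := (measurable_const.mul hf).ennreal_ofReal
    have hFx : Measurable fun y => ENNReal.ofReal ((f x - f y) ^ 2) := ((measurable_const.sub hf).pow_const 2).ennreal_ofReal
    rw [← lintegral_const_mul _ hGx, ← lintegral_add_left hFx]
    have hpt : ∀ y, ENNReal.ofReal ((f x - f y) ^ 2) + 2 * ENNReal.ofReal (f x * f y) = ENNReal.ofReal (f x ^ 2) + ENNReal.ofReal (f y ^ 2) := by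
      intro y
      have hxy : 0 ≤ f x * f y := mul_nonneg (hf0 x) (hf0 y)
      rw [show (2 : ℝ≥0∞) = ENNReal.ofReal 2 by norm_num, ← ENNReal.ofReal_mul zero_le_two,
        ← ENNReal.ofReal_add (sq_nonneg _) (by positivity), ← ENNReal.ofReal_add (sq_nonneg _) (sq_nonneg _)]
      congr 1; ring
    simp_rw [hpt]
    rw [lintegral_add_left (show Measurable (fun _ : Ω => ENNReal.ofReal (f x ^ 2)) from measurable_const), lintegral_const, measure_univ,
      mul_one]
  rw [← lintegral_const_mul _ (hG.lintegral_kernel_prod_right), ← lintegral_add_left (hF.lintegral_kernel_prod_right)]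
  simp_rw [hin]
  rw [lintegral_add_left hsq]
  -- invariance: `∫ (P f²) dπ = ∫ f² dπ`
  have hI : ∫⁻ x, ∫⁻ y, ENNReal.ofReal (f y ^ 2) ∂(P x) ∂π = ∫⁻ x, ENNReal.ofReal (f x ^ 2) ∂π := by
    rw [← Measure.lintegral_bind (Kernel.aemeasurable P) hsq.aemeasurable, hinv.def]
  rw [hI, two_mul]

/-- **THE DOMINATING KERNEL HAS THE SMALLER LAG-ONE PRODUCT MOMENT**: if `P₂ ≤ P₁` off the diagonal, both are `π`-invariant Markov kernels, `π` is
finite and `0 ≤ f ≤ c` is measurable, then `∫∫ f(x)f(y) P₁(x, dy)π(dx) ≤ ∫∫ f(x)f(y) P₂(x, dy)π(dx)`. [ours] -/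
theorem lagOne_cross_antitone [MeasurableSingletonClass Ω] (P₁ P₂ : Kernel Ω Ω) [IsMarkovKernel P₁] [IsMarkovKernel P₂]
    (hdom : ∀ x ⦃B : Set Ω⦄, MeasurableSet B → x ∉ B → P₂ x B ≤ P₁ x B) (π : Measure Ω) [IsFiniteMeasure π]
    (h₁ : Kernel.Invariant P₁ π) (h₂ : Kernel.Invariant P₂ π) {f : Ω → ℝ} (hf : Measurable f) (hf0 : ∀ x, 0 ≤ f x) {c : ℝ} (hfc : ∀ x, f x ≤ c) :
    ∫⁻ x, ∫⁻ y, ENNReal.ofReal (f x * f y) ∂(P₁ x) ∂π ≤ ∫⁻ x, ∫⁻ y, ENNReal.ofReal (f x * f y) ∂(P₂ x) ∂π := by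
  have e₁ := sqDiff_add_two_cross_eq P₁ π h₁ hf hf0
  have e₂ := sqDiff_add_two_cross_eq P₂ π h₂ hf hf0
  have hmono := sqDiff_lintegral_mono P₁ P₂ hdom π f
  -- everything is finite: bounded integrands against finite measures
  have hfin : ∀ (P : Kernel Ω Ω) [IsMarkovKernel P], ∫⁻ x, ∫⁻ y, ENNReal.ofReal (f x * f y) ∂(P x) ∂π ≠ ⊤ := fun P _ => by
    refine ne_top_of_le_ne_top (ENNReal.mul_ne_top (ENNReal.ofReal_ne_top (r := c * c)) (measure_ne_top π Set.univ)) ?_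
    calc ∫⁻ x, ∫⁻ y, ENNReal.ofReal (f x * f y) ∂(P x) ∂π ≤ ∫⁻ _, ENNReal.ofReal (c * c) ∂π := by
          refine lintegral_mono fun x => ?_
          calc ∫⁻ y, ENNReal.ofReal (f x * f y) ∂(P x) ≤ ∫⁻ _, ENNReal.ofReal (c * c) ∂(P x) :=
                lintegral_mono fun y => ENNReal.ofReal_le_ofReal (mul_le_mul (hfc x) (hfc y) (hf0 y) ((hf0 x).trans (hfc x)))
            _ = ENNReal.ofReal (c * c) := by rw [lintegral_const, measure_univ, mul_one]
      _ = ENNReal.ofReal (c * c) * π Set.univ := lintegral_const _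
  set S₁ := ∫⁻ x, ∫⁻ y, ENNReal.ofReal ((f x - f y) ^ 2) ∂(P₁ x) ∂π
  set S₂ := ∫⁻ x, ∫⁻ y, ENNReal.ofReal ((f x - f y) ^ 2) ∂(P₂ x) ∂π
  set C₁ := ∫⁻ x, ∫⁻ y, ENNReal.ofReal (f x * f y) ∂(P₁ x) ∂π
  set C₂ := ∫⁻ x, ∫⁻ y, ENNReal.ofReal (f x * f y) ∂(P₂ x) ∂π
  -- `S₁ + 2C₁ = S₂ + 2C₂` with `S₂ ≤ S₁` forces `2C₁ ≤ 2C₂`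
  have hsum : S₁ + 2 * C₁ = S₂ + 2 * C₂ := by rw [e₁, e₂]
  have hsq_fin : 2 * ∫⁻ x, ENNReal.ofReal (f x ^ 2) ∂π ≠ ⊤ := by
    refine ENNReal.mul_ne_top (by norm_num) (ne_top_of_le_ne_top (ENNReal.mul_ne_top (ENNReal.ofReal_ne_top (r := c ^ 2)) (measure_ne_top π Set.univ)) ?_)
    calc ∫⁻ x, ENNReal.ofReal (f x ^ 2) ∂π ≤ ∫⁻ _, ENNReal.ofReal (c ^ 2) ∂π :=
          lintegral_mono fun x => ENNReal.ofReal_le_ofReal (pow_le_pow_left₀ (hf0 x) (hfc x) 2)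
      _ = ENNReal.ofReal (c ^ 2) * π Set.univ := lintegral_const _
  have hS₂ : S₂ ≠ ⊤ := ne_top_of_le_ne_top hsq_fin (le_self_add.trans_eq e₂)
  have h2 : 2 * C₁ ≤ 2 * C₂ := by
    by_contra hlt
    rw [not_le] at hlt
    have : S₂ + 2 * C₂ < S₁ + 2 * C₁ := ENNReal.add_lt_add_of_le_of_lt hS₂ hmono hlt
    exact absurd hsum (ne_of_gt this)
  have h2' : (2 : ℝ≥0∞) ≠ 0 := two_ne_zero
  have h2T : (2 : ℝ≥0∞) ≠ ⊤ := ENNReal.ofNat_ne_top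
  calc C₁ = 2⁻¹ * (2 * C₁) := by rw [← mul_assoc, ENNReal.inv_mul_cancel h2' h2T, one_mul]
    _ ≤ 2⁻¹ * (2 * C₂) := mul_le_mul' le_rfl h2
    _ = C₂ := by rw [← mul_assoc, ENNReal.inv_mul_cancel h2' h2T, one_mul]

/-! ## §3 Multiple try versus pool selection -/

variable {q : Measure Ω} [IsProbabilityMeasure q] {w : Ω → ℝ} {n : ℕ}

/-- **THE MULTIPLE-TRY FLOW SAMPLER DECORRELATES EVERY OBSERVABLE AT LAG ONE AT LEAST AS MUCH AS POOL SELECTION**: for the same flow, normalised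
positive weight and batch size, and every measurable `0 ≤ f ≤ c`, the stationary lag-one product moment `∫∫ f(x)f(y) P(x, dy)π(dx)` of the
multiple-try kernel is at most the pool-selection kernel's. [ours] -/
theorem multiProposal_lagOne_ge_mtm [MeasurableSingletonClass Ω] (hw : Measurable w) (hw0 : ∀ y, 0 < w y)
    [IsProbabilityMeasure (q.withDensity fun y => ENNReal.ofReal (w y))] (P Pm : Kernel Ω Ω)
    (hP : ∀ (x : Ω) {B : Set Ω}, MeasurableSet B → P x B = ∫⁻ y, (∑ j, ENNReal.ofReal (w (Fin.cons (α := fun _ : Fin (n + 1) => Ω) x y j)) *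
      B.indicator (fun _ => (1 : ℝ≥0∞)) (Fin.cons (α := fun _ : Fin (n + 1) => Ω) x y j)) /
      (∑ i, ENNReal.ofReal (w (Fin.cons (α := fun _ : Fin (n + 1) => Ω) x y i))) ∂(Measure.pi fun _ : Fin n => q))
    (hPm : ∀ (x : Ω) {B : Set Ω}, MeasurableSet B → Pm x B =
      ∫⁻ y, ∑ J : Fin n, ENNReal.ofReal (w (Fin.cons (α := fun _ : Fin (n + 1) => Ω) x y J.succ)) *
          B.indicator (fun _ => (1 : ℝ≥0∞)) (Fin.cons (α := fun _ : Fin (n + 1) => Ω) x y J.succ) *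
          min (∑ i ∈ univ.erase 0, ENNReal.ofReal (w (Fin.cons (α := fun _ : Fin (n + 1) => Ω) x y i)))⁻¹
            (∑ i ∈ univ.erase J.succ, ENNReal.ofReal (w (Fin.cons (α := fun _ : Fin (n + 1) => Ω) x y i)))⁻¹ ∂(Measure.pi fun _ : Fin n => q) +
        (1 - ∫⁻ y, ∑ J : Fin n, ENNReal.ofReal (w (Fin.cons (α := fun _ : Fin (n + 1) => Ω) x y J.succ)) *
          min (∑ i ∈ univ.erase 0, ENNReal.ofReal (w (Fin.cons (α := fun _ : Fin (n + 1) => Ω) x y i)))⁻¹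
            (∑ i ∈ univ.erase J.succ, ENNReal.ofReal (w (Fin.cons (α := fun _ : Fin (n + 1) => Ω) x y i)))⁻¹ ∂(Measure.pi fun _ : Fin n => q)) *
          B.indicator 1 x)
    {f : Ω → ℝ} (hf : Measurable f) (hf0 : ∀ x, 0 ≤ f x) {c : ℝ} (hfc : ∀ x, f x ≤ c) :
    ∫⁻ x, ∫⁻ y, ENNReal.ofReal (f x * f y) ∂(Pm x) ∂(q.withDensity fun y => ENNReal.ofReal (w y)) ≤
      ∫⁻ x, ∫⁻ y, ENNReal.ofReal (f x * f y) ∂(P x) ∂(q.withDensity fun y => ENNReal.ofReal (w y)) := by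
  set π : Measure Ω := q.withDensity fun y => ENNReal.ofReal (w y) with hπ
  haveI : IsMarkovKernel P := ⟨fun x => ⟨multiProposal_apply_univ hw0 P hP x⟩⟩
  haveI : IsMarkovKernel Pm := ⟨fun x => ⟨mtm_apply_univ hw0 Pm hPm x⟩⟩
  have hinvP : Kernel.Invariant P π := by
    show π.bind P = π
    ext B hB
    rw [Measure.bind_apply hB (Kernel.aemeasurable _)]
    exact multiProposal_invariant hw hw0 P hP hB
  have hinvPm : Kernel.Invariant Pm π := by
    show π.bind Pm = π
    ext B hB
    rw [Measure.bind_apply hB (Kernel.aemeasurable _)]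
    exact mtm_invariant hw hw0 Pm hPm hB
  exact lagOne_cross_antitone Pm P (fun x B hB hx => multiProposal_apply_le_mtm_apply P Pm hP hPm hB hx) π hinvPm hinvP hf hf0 hfc

end Summit.Ventures.LatticeQCDFlow.Exactness
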